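import Literature.GroupTheory.CombinatorialGroupTheory.PuncturedSurfaceGroupCuspBasesLast
import Literature.GroupTheory.CombinatorialGroupTheory.PuncturedSurfaceGroupTwoComponentBases
import HarnessLib

/-!
# Free bases of `Γ_{g,r}` adapted to the two-component curve with TWO nodes (dual graph a 2-cycle)

`Γ_{g,r'+1} = ⟨a_i, b_i, c_j ∣ (∏_i [a_i,b_i]) c_0 ⋯ c_{r'}⟩` ([SemiAnbd] Ex. 2.10
[cite: MochizukiSemiAnbd2006, Ex. 2.10 p.31]).  The degeneration of a smooth curve of type `(g, r'+1)` to
TWO components `C₀`, `C₁` joined at TWO nodes (first Betti number of the dual graph `1`): in the standard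
generators the handle `m` "opens up" into the cycle; `C₀` carries the handles `i < m` and the cusps
`j ≥ s`, `C₁` the handles `i > m` and the cusps `j < s` (`1 ≤ s ≤ r'`: both components marked); the
two vanishing cycles are `b_m` (node `ν₁`) and
`δ = (c_0⋯c_{s-1})⁻¹ (∏_{i>m}[a_i,b_i])⁻¹ b_m = (c_s⋯c_{r'}) (∏_{i<m}[a_i,b_i]) · a_m b_m a_m⁻¹` (node `ν₂`;
the two expressions agree by the surface relation, `nodeLoop₂_eq`), and the vertex groups are
`Π_{v₀} = ⟨a_i, b_i (i<m), c_j (j ≥ s), a_m b_m a_m⁻¹, δ⟩`, `Π_{v₁} = ⟨a_i, b_i (i>m), c_j (j<s), b_m, δ⟩`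
(genus `m` resp. `g − m − 1`, arithmetic genus `g`).  All four are closures of FREE FACTORS:

* `exists_freeGroupBasis_cycleFirst` — the `c₀`-eliminating basis with the letter `b_m` replaced by
  `a_m b_m a_m⁻¹` (three Nielsen moves); `closure_cycleFirst_eq` — `Π_{v₀}` is the closure of its
  sub-basis `S_A`;
* `closure_cycleSecond_eq` — `Π_{v₁}` is the closure of the sub-basis `S_B` of the `c_{r'}`-eliminating
  basis (`PuncturedSurfaceGroupCuspBasesLast.lean`);
* `exists_freeGroupBasis_cycleNode₂` — a basis containing `δ` (two Nielsen moves on the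
  `c_{r'}`-eliminating basis).
Theorems only; elementary combinatorial group theory.
-/

namespace Literature.GroupTheory.CombinatorialGroupTheory.PuncturedSurfaceGroup

variable {g r' m s : ℕ}

/-- **The second vanishing cycle**: with `δ = (c_0⋯c_{s−1})⁻¹ (∏_{i ≥ m+1}[a_i,b_i])⁻¹ b_m`, the surface
relation gives `δ = (c_s⋯c_{r'}) (∏_{i<m}[a_i,b_i]) a_m b_m a_m⁻¹`. [cite: MochizukiSemiAnbd2006, Ex. 2.10 p.31] -/
theorem nodeLoop₂_eq (hm : m < g) (δ : PuncturedSurfaceGroup g (r' + 1))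
    (hδ : δ = (((List.finRange (r' + 1)).map fun j : Fin (r' + 1) =>
        if (j : ℕ) < s then c (g := g) j else 1).prod)⁻¹ *
      (((List.finRange g).map fun i : Fin g => if m + 1 ≤ (i : ℕ) then
        a (r := r' + 1) i * b i * (a i)⁻¹ * (b i)⁻¹ else 1).prod)⁻¹ * b ⟨m, hm⟩) :
    δ = ((List.finRange (r' + 1)).map fun j : Fin (r' + 1) =>
        if s ≤ (j : ℕ) then c (g := g) j else 1).prod *
      ((List.finRange g).map fun i : Fin g => if (i : ℕ) < m then
        a (r := r' + 1) i * b i * (a i)⁻¹ * (b i)⁻¹ else 1).prod *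
      (a ⟨m, hm⟩ * b ⟨m, hm⟩ * (a ⟨m, hm⟩)⁻¹) := by
  classical
  have h := comm_split_mul_cusp_split_eq_one (g := g) (r := r' + 1) m s
  rw [prod_map_finRange_ite_le_peel g m hm] at h
  set Xl := ((List.finRange g).map fun i : Fin g => if (i : ℕ) < m then
    a (r := r' + 1) i * b i * (a i)⁻¹ * (b i)⁻¹ else 1).prod
  set Xr := ((List.finRange g).map fun i : Fin g => if m + 1 ≤ (i : ℕ) then
    a (r := r' + 1) i * b i * (a i)⁻¹ * (b i)⁻¹ else 1).prod
  set Cl := ((List.finRange (r' + 1)).map fun j : Fin (r' + 1) => if (j : ℕ) < s then c (g := g) j else 1).prod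
  set Cr := ((List.finRange (r' + 1)).map fun j : Fin (r' + 1) => if s ≤ (j : ℕ) then c (g := g) j else 1).prod
  -- `h : Xl * (a b a⁻¹ b⁻¹ * Xr) * (Cl * Cr) = 1`
  rw [hδ]
  have h2 : Cr * Xl * (a ⟨m, hm⟩ * b ⟨m, hm⟩ * (a ⟨m, hm⟩)⁻¹) * ((b ⟨m, hm⟩)⁻¹ * Xr * Cl) = 1 := by
    calc Cr * Xl * (a ⟨m, hm⟩ * b ⟨m, hm⟩ * (a ⟨m, hm⟩)⁻¹) * ((b ⟨m, hm⟩)⁻¹ * Xr * Cl)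
        = Cr * (Xl * (a ⟨m, hm⟩ * b ⟨m, hm⟩ * (a ⟨m, hm⟩)⁻¹ * (b ⟨m, hm⟩)⁻¹ * Xr) * (Cl * Cr)) * Cr⁻¹ := by
          group
      _ = 1 := by rw [h]; group
  have h3 := eq_inv_of_mul_eq_one_left h2
  rw [h3]
  group

section Bases

variable (hm : m < g)

/-- **The free basis of the FIRST component of the 2-cycle**: the `c₀`-eliminating basis of `Γ_{g,r'+1}`
with its letter `b_m` replaced by `a_m b_m a_m⁻¹` (Nielsen: invert, left-multiply by `a_m`, right-multiply
by `a_m⁻¹`). [cite: MochizukiSemiAnbd2006, Ex. 2.10 p.31] -/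
theorem exists_freeGroupBasis_cycleFirst (g r' m : ℕ) (hm : m < g) :
    ∃ bA : FreeGroupBasis ((Fin g × Bool) ⊕ Fin r') (PuncturedSurfaceGroup g (r' + 1)),
      (∀ i, bA (Sum.inl (i, false)) = a i) ∧ (∀ i, i ≠ ⟨m, hm⟩ → bA (Sum.inl (i, true)) = b i) ∧
        bA (Sum.inl (⟨m, hm⟩, true)) = a ⟨m, hm⟩ * b ⟨m, hm⟩ * (a ⟨m, hm⟩)⁻¹ ∧
        ∀ j : Fin r', bA (Sum.inr j) = c (Fin.succ j) := by
  classical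
  obtain ⟨b₀, ha, hb, hc⟩ := exists_freeGroupBasis_elim_zero g r'
  set k : (Fin g × Bool) ⊕ Fin r' := Sum.inl (⟨m, hm⟩, true) with hk
  have hak : ∀ (bb : FreeGroupBasis ((Fin g × Bool) ⊕ Fin r') (PuncturedSurfaceGroup g (r' + 1))),
      bb (Sum.inl (⟨m, hm⟩, false)) = a ⟨m, hm⟩ → a ⟨m, hm⟩ ∈ Subgroup.closure (bb '' {j | j ≠ k}) :=
    fun bb hbb => Subgroup.subset_closure ⟨Sum.inl (⟨m, hm⟩, false), by simp [hk], hbb⟩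
  -- move 1: `b_m ↦ b_m⁻¹`
  obtain ⟨b₁, hb₁k, hb₁⟩ := exists_freeGroupBasis_update_inv b₀ k
  -- move 2: `b_m⁻¹ ↦ a_m · (b_m⁻¹)⁻¹ = a_m b_m`
  obtain ⟨b₂, hb₂k, hb₂⟩ := exists_freeGroupBasis_update_mul_inv b₁ k (a ⟨m, hm⟩)
    (hak b₁ (by rw [hb₁ _ (by simp [hk]), ha]))
  -- move 3: `a_m b_m ↦ a_m b_m · a_m⁻¹`
  obtain ⟨b₃, hb₃k, hb₃⟩ := exists_freeGroupBasis_update_mul b₂ k (a ⟨m, hm⟩)⁻¹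
    (Subgroup.inv_mem _ (hak b₂ (by rw [hb₂ _ (by simp [hk]), hb₁ _ (by simp [hk]), ha])))
  refine ⟨b₃, fun i => ?_, fun i hi => ?_, ?_, fun j => ?_⟩
  · rw [hb₃ _ (by simp [hk]), hb₂ _ (by simp [hk]), hb₁ _ (by simp [hk]), ha]
  · have hne : (Sum.inl (i, true) : (Fin g × Bool) ⊕ Fin r') ≠ k := by simpa [hk] using hi
    rw [hb₃ _ hne, hb₂ _ hne, hb₁ _ hne, hb]
  · rw [hb₃k, hb₂k, hb₁k, inv_inv]
    change a ⟨m, hm⟩ * b₀ (Sum.inl (⟨m, hm⟩, true)) * (a ⟨m, hm⟩)⁻¹ = _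
    rw [hb]
  · rw [hb₃ _ (by simp [hk]), hb₂ _ (by simp [hk]), hb₁ _ (by simp [hk]), hc]

/-- **A free basis containing the second vanishing cycle `δ`**: the `c_{r'}`-eliminating basis with its
letter `b_m` replaced by `δ = u · b_m`, `u = (c_0⋯c_{s−1})⁻¹ (∏_{i>m}[a_i,b_i])⁻¹` a word in the other
letters (`s ≤ r'`). [cite: MochizukiSemiAnbd2006, Ex. 2.10 p.31] -/
theorem exists_freeGroupBasis_cycleNode₂ (g r' m s : ℕ) (hm : m < g) (hs : s ≤ r')
    (δ : PuncturedSurfaceGroup g (r' + 1))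
    (hδ : δ = (((List.finRange (r' + 1)).map fun j : Fin (r' + 1) =>
        if (j : ℕ) < s then c (g := g) j else 1).prod)⁻¹ *
      (((List.finRange g).map fun i : Fin g => if m + 1 ≤ (i : ℕ) then
        a (r := r' + 1) i * b i * (a i)⁻¹ * (b i)⁻¹ else 1).prod)⁻¹ * b ⟨m, hm⟩) :
    ∃ (bN : FreeGroupBasis ((Fin g × Bool) ⊕ Fin r') (PuncturedSurfaceGroup g (r' + 1))),
      bN (Sum.inl (⟨m, hm⟩, true)) = δ := by
  classical
  obtain ⟨bl, ha, hb, hc⟩ := exists_freeGroupBasis_elim_last g r'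
  set k : (Fin g × Bool) ⊕ Fin r' := Sum.inl (⟨m, hm⟩, true) with hk
  set u : PuncturedSurfaceGroup g (r' + 1) := (((List.finRange (r' + 1)).map fun j : Fin (r' + 1) =>
        if (j : ℕ) < s then c (g := g) j else 1).prod)⁻¹ *
      (((List.finRange g).map fun i : Fin g => if m + 1 ≤ (i : ℕ) then
        a (r := r' + 1) i * b i * (a i)⁻¹ * (b i)⁻¹ else 1).prod)⁻¹ with hu
  have hmem : ∀ (bb : FreeGroupBasis ((Fin g × Bool) ⊕ Fin r') (PuncturedSurfaceGroup g (r' + 1))),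
      (∀ i, bb (Sum.inl (i, false)) = a i) → (∀ i, i ≠ ⟨m, hm⟩ → bb (Sum.inl (i, true)) = b i) →
      (∀ j : Fin r', bb (Sum.inr j) = c (Fin.castSucc j)) → u ∈ Subgroup.closure (bb '' {j | j ≠ k}) := by
    intro bb hba hbb hbc
    refine Subgroup.mul_mem _ (Subgroup.inv_mem _ (prod_map_finRange_ite_mem _ _ _ _ fun j hj => ?_))
      (Subgroup.inv_mem _ (comm_prod_ite_mem _ _ (fun i hi => ?_) (fun i hi => ?_)))
    · have hjr : (j : ℕ) < r' := by omega
      have e : Fin.castSucc ⟨j, hjr⟩ = j := Fin.ext rfl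
      rw [← e, ← hbc]
      exact Subgroup.subset_closure ⟨Sum.inr ⟨j, hjr⟩, by simp [hk], rfl⟩
    · rw [← hba]
      exact Subgroup.subset_closure ⟨Sum.inl (i, false), by simp [hk], rfl⟩
    · have hi' : i ≠ ⟨m, hm⟩ := fun h => by subst h; simp at hi
      rw [← hbb i hi']
      exact Subgroup.subset_closure ⟨Sum.inl (i, true), by simpa [hk] using hi', rfl⟩
  obtain ⟨b₁, hb₁k, hb₁⟩ := exists_freeGroupBasis_update_inv bl k
  obtain ⟨b₂, hb₂k, hb₂⟩ := exists_freeGroupBasis_update_mul_inv b₁ k u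
    (hmem b₁ (fun i => by rw [hb₁ _ (by simp [hk]), ha])
      (fun i hi => by rw [hb₁ _ (by simpa [hk] using hi), hb]) (fun j => by rw [hb₁ _ (by simp [hk]), hc]))
  refine ⟨b₂, ?_⟩
  rw [hb₂k, hb₁k, inv_inv]
  change u * bl (Sum.inl (⟨m, hm⟩, true)) = δ
  rw [hb, hδ]

end Bases

/-! ### The two vertex groups as sub-basis closures -/

section Closures

variable (hm : m < g) {δ : PuncturedSurfaceGroup g (r' + 1)}
  (hδ : δ = (((List.finRange (r' + 1)).map fun j : Fin (r' + 1) =>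
        if (j : ℕ) < s then c (g := g) j else 1).prod)⁻¹ *
      (((List.finRange g).map fun i : Fin g => if m + 1 ≤ (i : ℕ) then
        a (r := r' + 1) i * b i * (a i)⁻¹ * (b i)⁻¹ else 1).prod)⁻¹ * b ⟨m, hm⟩)

include hδ in
/-- **`Π_{v₀}` of the 2-cycle in the basis `bA`**: for `1 ≤ s`,
`⟨a_i, b_i (i<m), c_j (j≥s), a_m b_m a_m⁻¹, δ⟩ = ⟨bA(S_A)⟩`, `S_A = {(i,·) : i<m} ∪ {(m,true)} ∪ {j : s ≤ j+1}`.
[cite: MochizukiSemiAnbd2006, Ex. 2.10 p.31] -/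
theorem closure_cycleFirst_eq (hs : 1 ≤ s)
    {bA : FreeGroupBasis ((Fin g × Bool) ⊕ Fin r') (PuncturedSurfaceGroup g (r' + 1))}
    (ha : ∀ i, bA (Sum.inl (i, false)) = a i) (hb : ∀ i, i ≠ ⟨m, hm⟩ → bA (Sum.inl (i, true)) = b i)
    (hk : bA (Sum.inl (⟨m, hm⟩, true)) = a ⟨m, hm⟩ * b ⟨m, hm⟩ * (a ⟨m, hm⟩)⁻¹)
    (hc : ∀ j : Fin r', bA (Sum.inr j) = c (Fin.succ j)) :
    Subgroup.closure {x : PuncturedSurfaceGroup g (r' + 1) |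
        (∃ i : Fin g, (i : ℕ) < m ∧ (x = a i ∨ x = b i)) ∨ (∃ j : Fin (r' + 1), s ≤ (j : ℕ) ∧ x = c j) ∨
        x = a ⟨m, hm⟩ * b ⟨m, hm⟩ * (a ⟨m, hm⟩)⁻¹ ∨ x = δ} =
      Subgroup.closure (bA '' {y | Sum.elim (fun p : Fin g × Bool => (p.1 : ℕ) < m ∨ (p.1 = ⟨m, hm⟩ ∧ p.2 = true))
        (fun j : Fin r' => s ≤ (j : ℕ) + 1) y}) := by
  classical
  set S_A : Set ((Fin g × Bool) ⊕ Fin r') := {y | Sum.elim (fun p : Fin g × Bool =>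
    (p.1 : ℕ) < m ∨ (p.1 = ⟨m, hm⟩ ∧ p.2 = true)) (fun j : Fin r' => s ≤ (j : ℕ) + 1) y} with hS_A
  have haR : ∀ i : Fin g, (i : ℕ) < m → a (r := r' + 1) i ∈ Subgroup.closure (bA '' S_A) := fun i hi =>
    Subgroup.subset_closure ⟨Sum.inl (i, false), Or.inl hi, ha i⟩
  have hbR : ∀ i : Fin g, (i : ℕ) < m → b (r := r' + 1) i ∈ Subgroup.closure (bA '' S_A) := fun i hi =>
    Subgroup.subset_closure ⟨Sum.inl (i, true), Or.inl hi, hb i (fun h => by subst h; simp at hi)⟩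
  have hcR : ∀ j : Fin (r' + 1), s ≤ (j : ℕ) → c (g := g) j ∈ Subgroup.closure (bA '' S_A) := by
    intro j hj
    have hj0 : j ≠ 0 := by rintro rfl; simp at hj; omega
    rw [← Fin.succ_pred j hj0, ← hc]
    exact Subgroup.subset_closure ⟨Sum.inr (j.pred hj0), by
      change s ≤ ((j.pred hj0 : Fin r') : ℕ) + 1; rw [Fin.val_pred]; omega, rfl⟩
  have hkR : a ⟨m, hm⟩ * b ⟨m, hm⟩ * (a ⟨m, hm⟩)⁻¹ ∈ Subgroup.closure (bA '' S_A) := by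
    rw [← hk]; exact Subgroup.subset_closure ⟨Sum.inl (⟨m, hm⟩, true), Or.inr ⟨rfl, rfl⟩, rfl⟩
  have hδR : δ ∈ Subgroup.closure (bA '' S_A) := by
    rw [nodeLoop₂_eq hm δ hδ]
    exact Subgroup.mul_mem _ (Subgroup.mul_mem _ (prod_map_finRange_ite_mem _ _ _ _ hcR)
      (comm_prod_ite_mem _ _ haR hbR)) hkR
  apply le_antisymm
  · rw [Subgroup.closure_le]
    rintro x (⟨i, hi, rfl | rfl⟩ | ⟨j, hj, rfl⟩ | rfl | rfl)
    · exact haR i hi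
    · exact hbR i hi
    · exact hcR j hj
    · exact hkR
    · exact hδR
  · rw [Subgroup.closure_le]
    rintro _ ⟨y, hy, rfl⟩
    rcases y with ⟨i, _ | _⟩ | j
    · rcases hy with hy | ⟨-, hy⟩
      · rw [ha]; exact Subgroup.subset_closure (Or.inl ⟨i, hy, Or.inl rfl⟩)
      · exact absurd hy (by simp)
    · rcases hy with hy | ⟨rfl, -⟩
      · rw [hb i (fun h => by subst h; simp at hy)]
        exact Subgroup.subset_closure (Or.inl ⟨i, hy, Or.inr rfl⟩)
      · rw [hk]; exact Subgroup.subset_closure (Or.inr (Or.inr (Or.inl rfl)))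
    · rw [hc]
      exact Subgroup.subset_closure (Or.inr (Or.inl ⟨Fin.succ j, by change s ≤ (j : ℕ) + 1 at hy; simpa using hy, rfl⟩))

include hδ in
/-- **`Π_{v₁}` of the 2-cycle in the `c_{r'}`-eliminating basis**: for `s ≤ r'`,
`⟨a_i, b_i (i>m), c_j (j<s), b_m, δ⟩ = ⟨bl(S_B)⟩`, `S_B = {(i,·) : m<i} ∪ {(m,true)} ∪ {j : j<s}`.
[cite: MochizukiSemiAnbd2006, Ex. 2.10 p.31] -/
theorem closure_cycleSecond_eq (hs : s ≤ r')
    {bl : FreeGroupBasis ((Fin g × Bool) ⊕ Fin r') (PuncturedSurfaceGroup g (r' + 1))}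
    (ha : ∀ i, bl (Sum.inl (i, false)) = a i) (hb : ∀ i, bl (Sum.inl (i, true)) = b i)
    (hc : ∀ j : Fin r', bl (Sum.inr j) = c (Fin.castSucc j)) :
    Subgroup.closure {x : PuncturedSurfaceGroup g (r' + 1) |
        (∃ i : Fin g, m < (i : ℕ) ∧ (x = a i ∨ x = b i)) ∨ (∃ j : Fin (r' + 1), (j : ℕ) < s ∧ x = c j) ∨
        x = b ⟨m, hm⟩ ∨ x = δ} =
      Subgroup.closure (bl '' {y | Sum.elim (fun p : Fin g × Bool => m < (p.1 : ℕ) ∨ (p.1 = ⟨m, hm⟩ ∧ p.2 = true))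
        (fun j : Fin r' => (j : ℕ) < s) y}) := by
  classical
  set S_B : Set ((Fin g × Bool) ⊕ Fin r') := {y | Sum.elim (fun p : Fin g × Bool =>
    m < (p.1 : ℕ) ∨ (p.1 = ⟨m, hm⟩ ∧ p.2 = true)) (fun j : Fin r' => (j : ℕ) < s) y} with hS_B
  have haR : ∀ i : Fin g, m < (i : ℕ) → a (r := r' + 1) i ∈ Subgroup.closure (bl '' S_B) := fun i hi =>
    Subgroup.subset_closure ⟨Sum.inl (i, false), Or.inl hi, ha i⟩
  have hbR : ∀ i : Fin g, m < (i : ℕ) → b (r := r' + 1) i ∈ Subgroup.closure (bl '' S_B) := fun i hi =>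
    Subgroup.subset_closure ⟨Sum.inl (i, true), Or.inl hi, hb i⟩
  have hcR : ∀ j : Fin (r' + 1), (j : ℕ) < s → c (g := g) j ∈ Subgroup.closure (bl '' S_B) := by
    intro j hj
    have hjr : (j : ℕ) < r' := by omega
    have e : Fin.castSucc ⟨j, hjr⟩ = j := Fin.ext rfl
    rw [← e, ← hc]
    exact Subgroup.subset_closure ⟨Sum.inr ⟨j, hjr⟩, by change ((⟨j, hjr⟩ : Fin r') : ℕ) < s; exact hj, rfl⟩
  have hkR : b ⟨m, hm⟩ ∈ Subgroup.closure (bl '' S_B) := by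
    rw [← hb]; exact Subgroup.subset_closure ⟨Sum.inl (⟨m, hm⟩, true), Or.inr ⟨rfl, rfl⟩, rfl⟩
  have hδR : δ ∈ Subgroup.closure (bl '' S_B) := by
    rw [hδ]
    refine Subgroup.mul_mem _ (Subgroup.mul_mem _ (Subgroup.inv_mem _ (prod_map_finRange_ite_mem _ _ _ _ hcR))
      (Subgroup.inv_mem _ (comm_prod_ite_mem _ _ (fun i hi => haR i (by omega)) (fun i hi => hbR i (by omega)))))
      hkR
  apply le_antisymm
  · rw [Subgroup.closure_le]
    rintro x (⟨i, hi, rfl | rfl⟩ | ⟨j, hj, rfl⟩ | rfl | rfl)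
    · exact haR i hi
    · exact hbR i hi
    · exact hcR j hj
    · exact hkR
    · exact hδR
  · rw [Subgroup.closure_le]
    rintro _ ⟨y, hy, rfl⟩
    rcases y with ⟨i, _ | _⟩ | j
    · rcases hy with hy | ⟨-, hy⟩
      · rw [ha]; exact Subgroup.subset_closure (Or.inl ⟨i, hy, Or.inl rfl⟩)
      · exact absurd hy (by simp)
    · rcases hy with hy | ⟨rfl, -⟩
      · rw [hb]; exact Subgroup.subset_closure (Or.inl ⟨i, hy, Or.inr rfl⟩)
      · rw [hb]; exact Subgroup.subset_closure (Or.inr (Or.inr (Or.inl rfl)))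
    · rw [hc]
      exact Subgroup.subset_closure (Or.inr (Or.inl ⟨Fin.castSucc j, by change (j : ℕ) < s at hy; simpa using hy, rfl⟩))

end Closures


/-! ### The `δ`-basis with all its letter values (successor input for [CombGC] Prop. 1.5 (i) at the 2-cycle) -/

section DeltaBasis

/-- **The free basis containing `δ`, with ALL letter values recorded**: `bN(i,false) = a_i`,
`bN(i,true) = b_i` for `i ≠ m`, `bN(m,true) = δ`, `bN(inr j) = c_j` (`j < r'`) — the `c_{r'}`-eliminating
basis with the single letter `b_m` replaced by `δ = u · b_m`. [cite: MochizukiSemiAnbd2006, Ex. 2.10 p.31] -/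
theorem exists_freeGroupBasis_cycleNode₂_values (g r' m s : ℕ) (hm : m < g) (hs : s ≤ r')
    (δ : PuncturedSurfaceGroup g (r' + 1))
    (hδ : δ = (((List.finRange (r' + 1)).map fun j : Fin (r' + 1) =>
        if (j : ℕ) < s then c (g := g) j else 1).prod)⁻¹ *
      (((List.finRange g).map fun i : Fin g => if m + 1 ≤ (i : ℕ) then
        a (r := r' + 1) i * b i * (a i)⁻¹ * (b i)⁻¹ else 1).prod)⁻¹ * b ⟨m, hm⟩) :
    ∃ (bN : FreeGroupBasis ((Fin g × Bool) ⊕ Fin r') (PuncturedSurfaceGroup g (r' + 1))),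
      (∀ i, bN (Sum.inl (i, false)) = a i) ∧ (∀ i, i ≠ ⟨m, hm⟩ → bN (Sum.inl (i, true)) = b i) ∧
      bN (Sum.inl (⟨m, hm⟩, true)) = δ ∧ ∀ j : Fin r', bN (Sum.inr j) = c (Fin.castSucc j) := by
  classical
  obtain ⟨bl, ha, hb, hc⟩ := exists_freeGroupBasis_elim_last g r'
  set k : (Fin g × Bool) ⊕ Fin r' := Sum.inl (⟨m, hm⟩, true) with hk
  set u : PuncturedSurfaceGroup g (r' + 1) := (((List.finRange (r' + 1)).map fun j : Fin (r' + 1) =>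
        if (j : ℕ) < s then c (g := g) j else 1).prod)⁻¹ *
      (((List.finRange g).map fun i : Fin g => if m + 1 ≤ (i : ℕ) then
        a (r := r' + 1) i * b i * (a i)⁻¹ * (b i)⁻¹ else 1).prod)⁻¹ with hu
  have hmem : ∀ (bb : FreeGroupBasis ((Fin g × Bool) ⊕ Fin r') (PuncturedSurfaceGroup g (r' + 1))),
      (∀ i, bb (Sum.inl (i, false)) = a i) → (∀ i, i ≠ ⟨m, hm⟩ → bb (Sum.inl (i, true)) = b i) →
      (∀ j : Fin r', bb (Sum.inr j) = c (Fin.castSucc j)) → u ∈ Subgroup.closure (bb '' {j | j ≠ k}) := by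
    intro bb hba hbb hbc
    refine Subgroup.mul_mem _ (Subgroup.inv_mem _ (prod_map_finRange_ite_mem _ _ _ _ fun j hj => ?_))
      (Subgroup.inv_mem _ (comm_prod_ite_mem _ _ (fun i hi => ?_) (fun i hi => ?_)))
    · have hjr : (j : ℕ) < r' := by omega
      have e : Fin.castSucc ⟨j, hjr⟩ = j := Fin.ext rfl
      rw [← e, ← hbc]
      exact Subgroup.subset_closure ⟨Sum.inr ⟨j, hjr⟩, by simp [hk], rfl⟩
    · rw [← hba]
      exact Subgroup.subset_closure ⟨Sum.inl (i, false), by simp [hk], rfl⟩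
    · have hi' : i ≠ ⟨m, hm⟩ := fun h => by subst h; simp at hi
      rw [← hbb i hi']
      exact Subgroup.subset_closure ⟨Sum.inl (i, true), by simpa [hk] using hi', rfl⟩
  obtain ⟨b₁, hb₁k, hb₁⟩ := exists_freeGroupBasis_update_inv bl k
  have hb₁a : ∀ i, b₁ (Sum.inl (i, false)) = a i := fun i => by rw [hb₁ _ (by simp [hk]), ha]
  have hb₁b : ∀ i, i ≠ ⟨m, hm⟩ → b₁ (Sum.inl (i, true)) = b i := fun i hi => by
    rw [hb₁ _ (by simpa [hk] using hi), hb]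
  have hb₁c : ∀ j : Fin r', b₁ (Sum.inr j) = c (Fin.castSucc j) := fun j => by rw [hb₁ _ (by simp [hk]), hc]
  obtain ⟨b₂, hb₂k, hb₂⟩ := exists_freeGroupBasis_update_mul_inv b₁ k u (hmem b₁ hb₁a hb₁b hb₁c)
  refine ⟨b₂, fun i => ?_, fun i hi => ?_, ?_, fun j => ?_⟩
  · rw [hb₂ _ (by simp [hk]), hb₁a]
  · rw [hb₂ _ (by simpa [hk] using hi), hb₁b i hi]
  · rw [hb₂k, hb₁k, inv_inv]
    change u * bl (Sum.inl (⟨m, hm⟩, true)) = δ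
    rw [hb, hδ]
  · rw [hb₂ _ (by simp [hk]), hb₁c]


/-- **The free basis containing `δ` AND the cusp letters `c_1, …, c_{r'}`** (`1 ≤ s`): the basis `bA` of
`exists_freeGroupBasis_cycleFirst` (the `c_0`-eliminating basis with `b_m ↦ a_m b_m a_m⁻¹`) with that letter
further replaced by `δ = (c_s⋯c_{r'})([a_0,b_0]⋯[a_{m-1},b_{m-1}]) · a_m b_m a_m⁻¹` (`nodeLoop₂_eq`); values
`a_i`, `b_i (i ≠ m)`, `δ`, `c_{j+1}`.  With `exists_freeGroupBasis_cycleNode₂_values` (letters `c_0,…,c_{r'-1}`)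
every cusp shares a basis with `δ` — successor input for Prop. 1.5 (i) at the 2-cycle.
[cite: MochizukiSemiAnbd2006, Ex. 2.10 p.31] -/
theorem exists_freeGroupBasis_cycleNode₂_zero (g r' m s : ℕ) (hm : m < g) (hs : 1 ≤ s)
    (δ : PuncturedSurfaceGroup g (r' + 1))
    (hδ : δ = (((List.finRange (r' + 1)).map fun j : Fin (r' + 1) =>
        if (j : ℕ) < s then c (g := g) j else 1).prod)⁻¹ *
      (((List.finRange g).map fun i : Fin g => if m + 1 ≤ (i : ℕ) then
        a (r := r' + 1) i * b i * (a i)⁻¹ * (b i)⁻¹ else 1).prod)⁻¹ * b ⟨m, hm⟩) :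
    ∃ (bZ : FreeGroupBasis ((Fin g × Bool) ⊕ Fin r') (PuncturedSurfaceGroup g (r' + 1))),
      (∀ i, bZ (Sum.inl (i, false)) = a i) ∧ (∀ i, i ≠ ⟨m, hm⟩ → bZ (Sum.inl (i, true)) = b i) ∧
      bZ (Sum.inl (⟨m, hm⟩, true)) = δ ∧ ∀ j : Fin r', bZ (Sum.inr j) = c (Fin.succ j) := by
  classical
  obtain ⟨bA, ha, hb, hbk, hc⟩ := exists_freeGroupBasis_cycleFirst g r' m hm
  set k : (Fin g × Bool) ⊕ Fin r' := Sum.inl (⟨m, hm⟩, true) with hk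
  set U : PuncturedSurfaceGroup g (r' + 1) := ((List.finRange (r' + 1)).map fun j : Fin (r' + 1) =>
        if s ≤ (j : ℕ) then c (g := g) j else 1).prod *
      ((List.finRange g).map fun i : Fin g => if (i : ℕ) < m then
        a (r := r' + 1) i * b i * (a i)⁻¹ * (b i)⁻¹ else 1).prod with hU
  have hmem : ∀ (bb : FreeGroupBasis ((Fin g × Bool) ⊕ Fin r') (PuncturedSurfaceGroup g (r' + 1))),
      (∀ i, bb (Sum.inl (i, false)) = a i) → (∀ i, i ≠ ⟨m, hm⟩ → bb (Sum.inl (i, true)) = b i) →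
      (∀ j : Fin r', bb (Sum.inr j) = c (Fin.succ j)) → U ∈ Subgroup.closure (bb '' {j | j ≠ k}) := by
    intro bb hba hbb hbc
    refine Subgroup.mul_mem _ (prod_map_finRange_ite_mem _ _ _ _ fun j hj => ?_)
      (comm_prod_ite_mem _ _ (fun i hi => ?_) (fun i hi => ?_))
    · have hj0 : j ≠ 0 := fun h => by subst h; simp at hj; omega
      rw [← Fin.succ_pred j hj0, ← hbc]
      exact Subgroup.subset_closure ⟨Sum.inr (j.pred hj0), by simp [hk], rfl⟩
    · rw [← hba]
      exact Subgroup.subset_closure ⟨Sum.inl (i, false), by simp [hk], rfl⟩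
    · have hi' : i ≠ ⟨m, hm⟩ := fun h => by subst h; simp at hi
      rw [← hbb i hi']
      exact Subgroup.subset_closure ⟨Sum.inl (i, true), by simpa [hk] using hi', rfl⟩
  obtain ⟨b₁, hb₁k, hb₁⟩ := exists_freeGroupBasis_update_inv bA k
  have hb₁a : ∀ i, b₁ (Sum.inl (i, false)) = a i := fun i => by rw [hb₁ _ (by simp [hk]), ha]
  have hb₁b : ∀ i, i ≠ ⟨m, hm⟩ → b₁ (Sum.inl (i, true)) = b i := fun i hi => by
    rw [hb₁ _ (by simpa [hk] using hi), hb i hi]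
  have hb₁c : ∀ j : Fin r', b₁ (Sum.inr j) = c (Fin.succ j) := fun j => by rw [hb₁ _ (by simp [hk]), hc]
  obtain ⟨b₂, hb₂k, hb₂⟩ := exists_freeGroupBasis_update_mul_inv b₁ k U (hmem b₁ hb₁a hb₁b hb₁c)
  refine ⟨b₂, fun i => ?_, fun i hi => ?_, ?_, fun j => ?_⟩
  · rw [hb₂ _ (by simp [hk]), hb₁a]
  · rw [hb₂ _ (by simpa [hk] using hi), hb₁b i hi]
  · rw [hb₂k, hb₁k, inv_inv]
    change U * bA (Sum.inl (⟨m, hm⟩, true)) = δ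
    rw [hbk, nodeLoop₂_eq hm δ hδ]
  · rw [hb₂ _ (by simp [hk]), hb₁c]

end DeltaBasis

end Literature.GroupTheory.CombinatorialGroupTheory.PuncturedSurfaceGroup
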